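import Summits.CriticalPhenomena.PercolationContinuityZ3.Theorems.PercNearOneGluingNoHeavyLowerTailKnQuestion8CoefficientwiseCoreClassKernelMixBundleClassSchemes
import HarnessLib

/-!
# Boundary inequality on bundles, XVI: the chain lemma inside a red-prefix class and the two-type class count

Support file (`--supports stmt-CriticalPhenomena-4575`, closed), prover `prim-cplus-coupling` (gen 59).  No definitions, no notations, no named facts,
no sorries; standard axioms.  Memo `prim-cplus-coupling/A5-COUPLING-gen59.md` §1 (THEOREM CT, the clean-thread theorem).

SETTING as in `…KernelMixBundleClassSchemes`: explicit bundle, thread `z`, class `R_a(z) = {e z 1..a red, e z (a+1) blue}`.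
* `Coefficientwise.bundle_class_chain` — CHAIN LEMMA IN A CLASS: two colourings without a fully red thread, both in `R_a(z)` and both starting red on
  no thread other than `z` and `o`, have `⊆`-comparable red clusters of `u` (the clusters are `{u} ∪ I_z(a) ∪ I_o(·)`).
* `Coefficientwise.bundle_class_two_type_count` — threads `z, f₁, f₂`: if every type-1 source of `𝒱` in the class has `f₁` blue and starts red on
  `f₂`, and every type-2 source in the class has `f₂` blue and starts red on `f₁`, then `#bad₁(𝒱 ∩ R_a) + #bad₂(𝒱 ∩ R_a) ≤ #(L₁ ∪ L₂)(𝒱 ∩ R_a)`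
  (two slab schemes inside the class, `bundle_class_slab_count`; the landing sets are separated by the full thread `f₁`).
[cite: KozmaNitzan2024, Questions 8–9 (§5.5 p. 36) (context); Harris 1960]
-/

namespace Summit.CriticalPhenomena.PercolationContinuityZ3.Theorems

open Finset Literature.Probability.Percolation

namespace Coefficientwise

variable {ι V : Type*}


open Classical in
/-- **Chain lemma inside a red-prefix class.**  On an explicit bundle, two colourings `σ₁, σ₂ ⊆ E` without a fully red thread, both in the class
`R_a(z)` and both starting red on no thread other than `z` and `o`, have comparable red clusters of `u`.  Memo gen 59 §1.
[cite: KozmaNitzan2024, Questions 8–9 (§5.5 p. 36) (context)] -/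
theorem bundle_class_chain (ends : ι → Sym2 V) (r : ℕ) (L : ℕ → ℕ)
    (w : ℕ → ℕ → V) (e : ℕ → ℕ → ι) (u : V)
    (hw0 : ∀ t, t < r → w t 0 = u)
    (harc : ∀ t, t < r → ∀ j, 1 ≤ j → j ≤ L t → ends (e t j) = s(w t (j - 1), w t j))
    (hwinj : ∀ t, t < r → ∀ i j, i ≤ L t → j ≤ L t → w t i = w t j → i = j)
    (hcross : ∀ t t', t < r → t' < r → t ≠ t' → ∀ i j, i ≤ L t → j ≤ L t' → w t i = w t' j → (i = 0 ∧ j = 0) ∨ (i = L t ∧ j = L t'))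
    (E : Finset ι) (hE : ∀ i, i ∈ E → ∃ t, t < r ∧ ∃ j, 1 ≤ j ∧ j ≤ L t ∧ e t j = i)
    (z o a : ℕ) (σ₁ σ₂ : Finset ι) (hσ₁ : σ₁ ⊆ E) (hσ₂ : σ₂ ⊆ E)
    (hnf₁ : ∀ t, t < r → ∃ j, 1 ≤ j ∧ j ≤ L t ∧ e t j ∉ σ₁) (hnf₂ : ∀ t, t < r → ∃ j, 1 ≤ j ∧ j ≤ L t ∧ e t j ∉ σ₂)
    (hcl₁ : (∀ j, 1 ≤ j → j ≤ a → e z j ∈ σ₁) ∧ e z (a + 1) ∉ σ₁) (hcl₂ : (∀ j, 1 ≤ j → j ≤ a → e z j ∈ σ₂) ∧ e z (a + 1) ∉ σ₂)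
    (hstart₁ : ∀ t, t < r → t ≠ z → t ≠ o → e t 1 ∉ σ₁) (hstart₂ : ∀ t, t < r → t ≠ z → t ≠ o → e t 1 ∉ σ₂) :
    openCluster (ends '' (↑σ₁ : Set ι)) u ⊆ openCluster (ends '' (↑σ₂ : Set ι)) u ∨
      openCluster (ends '' (↑σ₂ : Set ι)) u ⊆ openCluster (ends '' (↑σ₁ : Set ι)) u := by
  -- a cluster vertex of σ outside the cluster of σ' is `w o j` with a red o-prefix in σ and a blue edge of σ' below it
  have key : ∀ σ σ' : Finset ι, σ ⊆ E → (∀ t, t < r → ∃ j, 1 ≤ j ∧ j ≤ L t ∧ e t j ∉ σ) →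
      ((∀ j, 1 ≤ j → j ≤ a → e z j ∈ σ) ∧ e z (a + 1) ∉ σ) → ((∀ j, 1 ≤ j → j ≤ a → e z j ∈ σ') ∧ e z (a + 1) ∉ σ') →
      (∀ t, t < r → t ≠ z → t ≠ o → e t 1 ∉ σ) →
      ∀ v, v ∈ openCluster (ends '' (↑σ : Set ι)) u → v ∉ openCluster (ends '' (↑σ' : Set ι)) u →
      o < r ∧ ∃ j, 1 ≤ j ∧ j < L o ∧ (∀ j', 1 ≤ j' → j' ≤ j → e o j' ∈ σ) ∧ ∃ j₁, 1 ≤ j₁ ∧ j₁ ≤ j ∧ e o j₁ ∉ σ' := by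
    intro σ σ' hσ hnf hcl hcl' hstart v hv hv'
    have h := bundle_cluster_subset_prefix ends r L w e u hw0 harc hwinj hcross E hE σ hσ hnf hv
    rcases h with h0 | ⟨t, ht, j, hj1, hjL, rfl, hrun⟩
    · exact absurd (h0 ▸ mem_openCluster_self _ _) hv'
    · by_cases htz : t = z
      · -- a red z-prefix of σ has length ≤ a, so it is red in σ' as well
        subst htz
        have hja : j ≤ a := by
          by_contra hja
          exact hcl.2 (hrun (a + 1) (by omega) (by omega))
        exact absurd (bundle_prefix_mem_cluster ends r L w e u hw0 harc σ' t ht j (le_of_lt hjL)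
          fun j' h1 h2 => hcl'.1 j' h1 (le_trans h2 hja)) hv'
      have hto : t = o := by
        by_contra hto
        exact hstart t ht htz hto (hrun 1 (le_refl 1) hj1)
      subst hto
      refine ⟨ht, j, hj1, hjL, hrun, ?_⟩
      by_contra hall
      push Not at hall
      exact hv' (bundle_prefix_mem_cluster ends r L w e u hw0 harc σ' t ht j (le_of_lt hjL) fun j' h1 h2 => hall j' h1 h2)
  by_contra hcon
  rw [not_or, Set.not_subset, Set.not_subset] at hcon
  obtain ⟨⟨v, hv, hv'⟩, ⟨v', hv'₂, hv'₁⟩⟩ := hcon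
  obtain ⟨_, j, _, _, hrun, j₁, hj₁1, hj₁j, hj₁⟩ := key σ₁ σ₂ hσ₁ hnf₁ hcl₁ hcl₂ hstart₁ v hv hv'
  obtain ⟨_, j', _, _, hrun', j₂, hj₂1, hj₂j, hj₂⟩ := key σ₂ σ₁ hσ₂ hnf₂ hcl₂ hcl₁ hstart₂ v' hv'₂ hv'₁
  have h1 : j' < j₁ := by
    by_contra h; exact hj₁ (hrun' j₁ hj₁1 (by omega))
  have h2 : j < j₂ := by
    by_contra h; exact hj₂ (hrun j₂ hj₂1 (by omega))
  omega

open Classical in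
/-- **Two-type class count.**  Explicit bundle with threads `z, f₁, f₂` (pairwise distinct), class `R_a(z)`.  If every type-1 source of `𝒱` in the class
has `f₁` blue and starts red on `f₂`, and every type-2 source in the class has `f₂` blue and starts red on `f₁`, then
`#bad₁(𝒱 ∩ R_a(z)) + #bad₂(𝒱 ∩ R_a(z)) ≤ #(L₁ ∪ L₂)(𝒱 ∩ R_a(z))`.  Memo gen 59 §1, case (ii).
[cite: KozmaNitzan2024, Questions 8–9 (§5.5 p. 36) (context); Harris 1960] -/
theorem bundle_class_two_type_count (ends : ι → Sym2 V) (r : ℕ) (L : ℕ → ℕ) (hL : ∀ t, t < r → 1 ≤ L t)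
    (w : ℕ → ℕ → V) (e : ℕ → ℕ → ι) (u b : V)
    (hw0 : ∀ t, t < r → w t 0 = u) (hwL : ∀ t, t < r → w t (L t) = b)
    (harc : ∀ t, t < r → ∀ j, 1 ≤ j → j ≤ L t → ends (e t j) = s(w t (j - 1), w t j))
    (hwinj : ∀ t, t < r → ∀ i j, i ≤ L t → j ≤ L t → w t i = w t j → i = j)
    (hcross : ∀ t t', t < r → t' < r → t ≠ t' → ∀ i j, i ≤ L t → j ≤ L t' → w t i = w t' j → (i = 0 ∧ j = 0) ∨ (i = L t ∧ j = L t'))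
    (A : ℕ → Finset ι) (hA : ∀ t, t < r → ∀ i, i ∈ A t ↔ ∃ j, 1 ≤ j ∧ j ≤ L t ∧ e t j = i)
    (hAdisj : ∀ t t', t < r → t' < r → t ≠ t' → Disjoint (A t) (A t'))
    (E : Finset ι) (hEA : ∀ i, i ∈ E ↔ ∃ t, t < r ∧ i ∈ A t)
    (z f₁ f₂ : ℕ) (hz : z < r) (hf₁ : f₁ < r) (hf₂ : f₂ < r) (hz1 : z ≠ f₁) (hz2 : z ≠ f₂) (h12 : f₁ ≠ f₂)
    (a : ℕ) (ha1 : 1 ≤ a) (haL : a + 1 ≤ L z)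
    (𝒱 : Finset ι → Prop) (hV : ∀ ⦃s t : Finset ι⦄, s ⊆ t → 𝒱 s → 𝒱 t)
    (ha hb ka kb : Set V → ℝ) (mha : Monotone ha) (mhb : Monotone hb) (mka : Monotone ka) (mkb : Monotone kb)
    (ha01 : ∀ S, ha S = 0 ∨ ha S = 1) (hb01 : ∀ S, hb S = 0 ∨ hb S = 1) (ka01 : ∀ S, ka S = 0 ∨ ka S = 1) (kb01 : ∀ S, kb S = 0 ∨ kb S = 1)
    (hT₁ : ∀ σ, σ ⊆ E → ((∀ j, 1 ≤ j → j ≤ a → e z j ∈ σ) ∧ e z (a + 1) ∉ σ) →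
      (𝒱 σ ∧ (b ∈ openCluster (ends '' (↑(E \ σ) : Set ι)) u ∧ b ∉ openCluster (ends '' (↑σ : Set ι)) u) ∧
        (ha (openCluster (ends '' (↑σ : Set ι)) u) = 1 ∧ hb (openCluster (ends '' (↑(E \ σ) : Set ι)) u) = 0) ∧
        (kb (openCluster (ends '' (↑(E \ σ) : Set ι)) u) = 1 ∧ ka (openCluster (ends '' (↑σ : Set ι)) u) = 0)) → Disjoint (A f₁) σ ∧ e f₂ 1 ∈ σ)
    (hT₂ : ∀ σ, σ ⊆ E → ((∀ j, 1 ≤ j → j ≤ a → e z j ∈ σ) ∧ e z (a + 1) ∉ σ) →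
      (𝒱 σ ∧ (b ∈ openCluster (ends '' (↑(E \ σ) : Set ι)) u ∧ b ∉ openCluster (ends '' (↑σ : Set ι)) u) ∧
        (ka (openCluster (ends '' (↑σ : Set ι)) u) = 1 ∧ kb (openCluster (ends '' (↑(E \ σ) : Set ι)) u) = 0) ∧
        (hb (openCluster (ends '' (↑(E \ σ) : Set ι)) u) = 1 ∧ ha (openCluster (ends '' (↑σ : Set ι)) u) = 0)) → Disjoint (A f₂) σ ∧ e f₁ 1 ∈ σ) :
    ((E.powerset).filter (fun σ => ((∀ j, 1 ≤ j → j ≤ a → e z j ∈ σ) ∧ e z (a + 1) ∉ σ) ∧ 𝒱 σ ∧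
        (b ∈ openCluster (ends '' (↑(E \ σ) : Set ι)) u ∧ b ∉ openCluster (ends '' (↑σ : Set ι)) u) ∧
        (ha (openCluster (ends '' (↑σ : Set ι)) u) = 1 ∧ hb (openCluster (ends '' (↑(E \ σ) : Set ι)) u) = 0) ∧
        (kb (openCluster (ends '' (↑(E \ σ) : Set ι)) u) = 1 ∧ ka (openCluster (ends '' (↑σ : Set ι)) u) = 0))).card
    + ((E.powerset).filter (fun σ => ((∀ j, 1 ≤ j → j ≤ a → e z j ∈ σ) ∧ e z (a + 1) ∉ σ) ∧ 𝒱 σ ∧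
        (b ∈ openCluster (ends '' (↑(E \ σ) : Set ι)) u ∧ b ∉ openCluster (ends '' (↑σ : Set ι)) u) ∧
        (ka (openCluster (ends '' (↑σ : Set ι)) u) = 1 ∧ kb (openCluster (ends '' (↑(E \ σ) : Set ι)) u) = 0) ∧
        (hb (openCluster (ends '' (↑(E \ σ) : Set ι)) u) = 1 ∧ ha (openCluster (ends '' (↑σ : Set ι)) u) = 0))).card
    ≤ ((E.powerset).filter (fun lam => ((∀ j, 1 ≤ j → j ≤ a → e z j ∈ lam) ∧ e z (a + 1) ∉ lam) ∧ 𝒱 lam ∧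
        (b ∈ openCluster (ends '' (↑lam : Set ι)) u ∧ b ∉ openCluster (ends '' (↑(E \ lam) : Set ι)) u) ∧
        ((ha (openCluster (ends '' (↑lam : Set ι)) u) = 1 ∧ kb (openCluster (ends '' (↑lam : Set ι)) u) = 1 ∧
            hb (openCluster (ends '' (↑(E \ lam) : Set ι)) u) = 0 ∧ ka (openCluster (ends '' (↑(E \ lam) : Set ι)) u) = 0) ∨
          (ka (openCluster (ends '' (↑lam : Set ι)) u) = 1 ∧ hb (openCluster (ends '' (↑lam : Set ι)) u) = 1 ∧
            kb (openCluster (ends '' (↑(E \ lam) : Set ι)) u) = 0 ∧ ha (openCluster (ends '' (↑(E \ lam) : Set ι)) u) = 0)))).card := by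
  set C : Finset ι → Set V := fun ω => openCluster (ends '' (↑ω : Set ι)) u with hC
  -- the two slab schemes inside the class
  have k₁ := bundle_class_slab_count ends r L hL w e u b hw0 hwL harc hwinj hcross A hA hAdisj E hEA f₁ f₂ z hf₁ hf₂ hz h12 hz1.symm hz2.symm a ha1 haL
    𝒱 hV ha hb ka kb mha mhb mka mkb ha01 hb01 ka01 kb01 (fun σ hσ _ hcl hs => (hT₁ σ hσ hcl hs).2)
  have k₂ := bundle_class_slab_count ends r L hL w e u b hw0 hwL harc hwinj hcross A hA hAdisj E hEA f₂ f₁ z hf₂ hf₁ hz h12.symm hz2.symm hz1.symm a ha1 haL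
    𝒱 hV ka kb ha hb mka mkb mha mhb ka01 kb01 ha01 hb01 (fun σ hσ _ hcl hs => (hT₂ σ hσ hcl hs).2)
  set M₁ : Finset (Finset ι) := (E.powerset).filter (fun lam => A f₁ ⊆ lam ∧ ((∀ j, 1 ≤ j → j ≤ a → e z j ∈ lam) ∧ e z (a + 1) ∉ lam) ∧
      (e f₂ 1 ∈ lam ∧ ¬ A f₂ ⊆ lam) ∧ 𝒱 (lam \ A f₁) ∧ (ha (C (lam \ A f₁)) = 1 ∧ hb (C (E \ (lam \ A f₁))) = 0) ∧ (b ∈ C lam ∧ b ∉ C (E \ lam)) ∧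
      (ha (C lam) = 1 ∧ kb (C lam) = 1 ∧ hb (C (E \ lam)) = 0 ∧ ka (C (E \ lam)) = 0)) with hM₁
  set M₂ : Finset (Finset ι) := (E.powerset).filter (fun lam => A f₂ ⊆ lam ∧ ((∀ j, 1 ≤ j → j ≤ a → e z j ∈ lam) ∧ e z (a + 1) ∉ lam) ∧
      (e f₁ 1 ∈ lam ∧ ¬ A f₁ ⊆ lam) ∧ 𝒱 (lam \ A f₂) ∧ (ka (C (lam \ A f₂)) = 1 ∧ kb (C (E \ (lam \ A f₂))) = 0) ∧ (b ∈ C lam ∧ b ∉ C (E \ lam)) ∧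
      (ka (C lam) = 1 ∧ hb (C lam) = 1 ∧ kb (C (E \ lam)) = 0 ∧ ha (C (E \ lam)) = 0)) with hM₂
  -- the landing sets are separated by the full thread `f₁`
  have hdisj : Disjoint M₁ M₂ := by
    rw [Finset.disjoint_left]
    intro lam h1 h2
    rw [hM₁, Finset.mem_filter] at h1
    rw [hM₂, Finset.mem_filter] at h2
    exact h2.2.2.2.1.2 h1.2.1
  have hsub : M₁ ∪ M₂ ⊆ (E.powerset).filter (fun lam => ((∀ j, 1 ≤ j → j ≤ a → e z j ∈ lam) ∧ e z (a + 1) ∉ lam) ∧ 𝒱 lam ∧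
      (b ∈ C lam ∧ b ∉ C (E \ lam)) ∧
      ((ha (C lam) = 1 ∧ kb (C lam) = 1 ∧ hb (C (E \ lam)) = 0 ∧ ka (C (E \ lam)) = 0) ∨
        (ka (C lam) = 1 ∧ hb (C lam) = 1 ∧ kb (C (E \ lam)) = 0 ∧ ha (C (E \ lam)) = 0))) := by
    intro lam hlam
    rcases Finset.mem_union.mp hlam with h | h
    · rw [hM₁, Finset.mem_filter] at h
      exact Finset.mem_filter.mpr ⟨h.1, h.2.2.1, hV Finset.sdiff_subset h.2.2.2.2.1, h.2.2.2.2.2.2.1, Or.inl h.2.2.2.2.2.2.2⟩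
    · rw [hM₂, Finset.mem_filter] at h
      exact Finset.mem_filter.mpr ⟨h.1, h.2.2.1, hV Finset.sdiff_subset h.2.2.2.2.1, h.2.2.2.2.2.2.1, Or.inr h.2.2.2.2.2.2.2⟩
  -- the sources of each type all lie in its slab
  have e₁ : (E.powerset).filter (fun σ => ((∀ j, 1 ≤ j → j ≤ a → e z j ∈ σ) ∧ e z (a + 1) ∉ σ) ∧ 𝒱 σ ∧ (b ∈ C (E \ σ) ∧ b ∉ C σ) ∧
      (ha (C σ) = 1 ∧ hb (C (E \ σ)) = 0) ∧ (kb (C (E \ σ)) = 1 ∧ ka (C σ) = 0)) =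
      (E.powerset).filter (fun σ => Disjoint (A f₁) σ ∧ ((∀ j, 1 ≤ j → j ≤ a → e z j ∈ σ) ∧ e z (a + 1) ∉ σ) ∧ 𝒱 σ ∧ (b ∈ C (E \ σ) ∧ b ∉ C σ) ∧
      (ha (C σ) = 1 ∧ hb (C (E \ σ)) = 0) ∧ (kb (C (E \ σ)) = 1 ∧ ka (C σ) = 0)) := by
    apply Finset.filter_congr
    intro σ hσ
    rw [Finset.mem_powerset] at hσ
    exact ⟨fun h => ⟨(hT₁ σ hσ h.1 h.2).1, h⟩, fun h => h.2⟩
  have e₂ : (E.powerset).filter (fun σ => ((∀ j, 1 ≤ j → j ≤ a → e z j ∈ σ) ∧ e z (a + 1) ∉ σ) ∧ 𝒱 σ ∧ (b ∈ C (E \ σ) ∧ b ∉ C σ) ∧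
      (ka (C σ) = 1 ∧ kb (C (E \ σ)) = 0) ∧ (hb (C (E \ σ)) = 1 ∧ ha (C σ) = 0)) =
      (E.powerset).filter (fun σ => Disjoint (A f₂) σ ∧ ((∀ j, 1 ≤ j → j ≤ a → e z j ∈ σ) ∧ e z (a + 1) ∉ σ) ∧ 𝒱 σ ∧ (b ∈ C (E \ σ) ∧ b ∉ C σ) ∧
      (ka (C σ) = 1 ∧ kb (C (E \ σ)) = 0) ∧ (hb (C (E \ σ)) = 1 ∧ ha (C σ) = 0)) := by
    apply Finset.filter_congr
    intro σ hσ
    rw [Finset.mem_powerset] at hσ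
    exact ⟨fun h => ⟨(hT₂ σ hσ h.1 h.2).1, h⟩, fun h => h.2⟩
  have b₁ : ((E.powerset).filter (fun σ => ((∀ j, 1 ≤ j → j ≤ a → e z j ∈ σ) ∧ e z (a + 1) ∉ σ) ∧ 𝒱 σ ∧ (b ∈ C (E \ σ) ∧ b ∉ C σ) ∧
      (ha (C σ) = 1 ∧ hb (C (E \ σ)) = 0) ∧ (kb (C (E \ σ)) = 1 ∧ ka (C σ) = 0))).card ≤ M₁.card := by
    rw [e₁]; convert k₁ using 3
  have b₂ : ((E.powerset).filter (fun σ => ((∀ j, 1 ≤ j → j ≤ a → e z j ∈ σ) ∧ e z (a + 1) ∉ σ) ∧ 𝒱 σ ∧ (b ∈ C (E \ σ) ∧ b ∉ C σ) ∧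
      (ka (C σ) = 1 ∧ kb (C (E \ σ)) = 0) ∧ (hb (C (E \ σ)) = 1 ∧ ha (C σ) = 0))).card ≤ M₂.card := by
    rw [e₂]; convert k₂ using 3
  have ecard := Finset.card_union_of_disjoint hdisj
  have c1 := Finset.card_le_card hsub
  have b₁' : ((E.powerset).filter (fun σ => ((∀ j, 1 ≤ j → j ≤ a → e z j ∈ σ) ∧ e z (a + 1) ∉ σ) ∧ 𝒱 σ ∧
      (b ∈ openCluster (ends '' (↑(E \ σ) : Set ι)) u ∧ b ∉ openCluster (ends '' (↑σ : Set ι)) u) ∧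
      (ha (openCluster (ends '' (↑σ : Set ι)) u) = 1 ∧ hb (openCluster (ends '' (↑(E \ σ) : Set ι)) u) = 0) ∧
      (kb (openCluster (ends '' (↑(E \ σ) : Set ι)) u) = 1 ∧ ka (openCluster (ends '' (↑σ : Set ι)) u) = 0))).card ≤ M₁.card := by
    convert b₁ using 3
  have b₂' : ((E.powerset).filter (fun σ => ((∀ j, 1 ≤ j → j ≤ a → e z j ∈ σ) ∧ e z (a + 1) ∉ σ) ∧ 𝒱 σ ∧
      (b ∈ openCluster (ends '' (↑(E \ σ) : Set ι)) u ∧ b ∉ openCluster (ends '' (↑σ : Set ι)) u) ∧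
      (ka (openCluster (ends '' (↑σ : Set ι)) u) = 1 ∧ kb (openCluster (ends '' (↑(E \ σ) : Set ι)) u) = 0) ∧
      (hb (openCluster (ends '' (↑(E \ σ) : Set ι)) u) = 1 ∧ ha (openCluster (ends '' (↑σ : Set ι)) u) = 0))).card ≤ M₂.card := by
    convert b₂ using 3
  have c1' : (M₁ ∪ M₂).card ≤ ((E.powerset).filter (fun lam => ((∀ j, 1 ≤ j → j ≤ a → e z j ∈ lam) ∧ e z (a + 1) ∉ lam) ∧ 𝒱 lam ∧
      (b ∈ openCluster (ends '' (↑lam : Set ι)) u ∧ b ∉ openCluster (ends '' (↑(E \ lam) : Set ι)) u) ∧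
      ((ha (openCluster (ends '' (↑lam : Set ι)) u) = 1 ∧ kb (openCluster (ends '' (↑lam : Set ι)) u) = 1 ∧
          hb (openCluster (ends '' (↑(E \ lam) : Set ι)) u) = 0 ∧ ka (openCluster (ends '' (↑(E \ lam) : Set ι)) u) = 0) ∨
        (ka (openCluster (ends '' (↑lam : Set ι)) u) = 1 ∧ hb (openCluster (ends '' (↑lam : Set ι)) u) = 1 ∧
          kb (openCluster (ends '' (↑(E \ lam) : Set ι)) u) = 0 ∧ ha (openCluster (ends '' (↑(E \ lam) : Set ι)) u) = 0)))).card := by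
    convert c1 using 3
  omega

end Coefficientwise

end Summit.CriticalPhenomena.PercolationContinuityZ3.Theorems
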